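import Summits.AtomisticToContinuum.HydrodynamicLimit.Theorems.CollisionIsometryCLTMacroClosureInBand
import HarnessLib

/-!
# Crux `MacroClosure` (stmt-AtomisticToContinuum-14870) — line `IdeatorTwoGen1Sketch`
(barycentric Bregman in conditional mean / invariant Clausius): lead skeleton, continuation c4 (2026-08-17; unchanged from c3 — the residue is the planners' item pair, see HANDOFF.md).

Crux: `Summit.AtomisticToContinuum.HydrodynamicLimit.Theses.CollisionIsometryCLT.MacroClosure :=
CollisionalTransferLocality → AprioriBoundsPreShock → FastMomentRelaxationPreShock → HydrodynamicLimit`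
(`_root_.HydrodynamicLimit` = the PACKING-GUARDED conjunct, `∃ η₀ > 0` OUTERMOST since the D-0032 re-type).

STATE (c3). The line's mathematics is COMPLETE and LANDED under `Theorems/CollisionIsometryCLTMacroClosure*.lean`:
* `MacroClosureInBand` (the crux on UNIFORM kinetic inputs) PROVED OUTRIGHT — `macroClosureInBand_proof` (p170415,
  `…InBand.lean`): thermodynamics `stub_thermo`, Ruelle convexity `stub_hsFreeEnergyConvex` (9526 closed), initial
  entropy `stub_initialEntropy`, the TWO-SCALE homogeneous block MGF `stub_blockMGF_twoScale` (p170105), two-scale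
  Clausius in mean `stub_clausius_twoScale` (p164223), the two-scale barycentric engine `stub_engine_twoScale`
  (p163836), docked with `η₀ := min η₃ (min η₁ᴬ η₁ᶠ)/2` chosen BEFORE the profiles;
* the crux as typed modulo the uniform inputs — `macroClosure_of_uniformInputs : AprioriBoundsInBand →
  FastMomentRelaxationInBand → MacroClosure` (p170415);
* the PER-PROFILE content of the crux as typed, unconditional — `engineLocal_proof : CollisionalTransferLocality →
  AprioriBoundsPreShock → FastMomentRelaxationPreShock → EngineLocal` (p172143, `…PerProfile.lean`), and its
  as-designed dock `macroClosure_of_dsc : ImplosionDichotomy.DiluteSelfConsistency → MacroClosure` (p172143).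

RESIDUE = QUANTIFIER ORDER, not mechanism: the hypotheses 14827/14902 fix the dilute level `η₁` AFTER the profiles
(`∀ profiles ∃ σ₀ ∃ η₁`), the conjunct fixes `η₀` BEFORE them; per-profile levels with `inf = 0` cannot feed a uniform
guard, so the only pure-logic closures of the crux AS TYPED are (a) uniform inputs (this skeleton's one stub) or
(b) `DiluteSelfConsistency` 3091 (`∀ η` outermost; expected false). The one registered stub is therefore the
planners' pair of UNIFORM kinetic inputs; no worker of this line can prove it (it is stmt-17749 ∧ the in-band hinge
`fmrInBand_of_engine` of DBI 12950 / AWCLT 14868 / 17749).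

Stubs (sorries ONLY in `stub_*`): `stub_uniformKineticInputs` ONLY.
-/

noncomputable section

open MeasureTheory Filter Set Topology InformationTheory
open scoped ENNReal ContDiff Convolution

namespace Summit.AtomisticToContinuum.HydrodynamicLimit.Theorems.MacroClosureLine

open Literature.MathematicalPhysics.KineticTheory Literature.Analysis.FluidPDE
open Literature.Analysis.FunctionSpaces
open Summit.AtomisticToContinuum.HydrodynamicLimit.Theses
open Summit.AtomisticToContinuum.HydrodynamicLimit.Theses.CollisionIsometryCLT

namespace Barycentric

/-! ## Stubs -/

/-- STUB (the UNIFORM kinetic inputs; planners' items, no prover of this line works them): the uniform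
pre-shock a-priori bounds (byte-identical with `StiffCollisionalRelaxation.AprioriBoundsInBand`, stmt-17749) AND the
uniform pre-shock kinetic hinge (body of stmt-14902 with `∃ η₁ > 0` outermost; child 2 of the strategist's split,
`fmrInBand_of_engine : DiffuseBackwardInfluence → AdaptedWeightCLT → AprioriBoundsInBand → ·` proved in
`Cruxes/MacroClosure/Lines/uniform_dock.lean`). -/
theorem stub_uniformKineticInputs :
    (∃ η₁ : ℝ, 0 < η₁ ∧ ∀ (a₀ θ₀ : (UnitAddTorus (Fin 3)) → ℝ) (u₀ : (UnitAddTorus (Fin 3)) → (EuclideanSpace ℝ (Fin 3))), Continuous a₀ → Continuous θ₀ → Continuous u₀ → (∀ x, 0 < a₀ x) → (∀ x, 0 < θ₀ x) → ∃ σ₀ : ℝ, 0 < σ₀ ∧ ∀ σ : ℝ, 0 < σ → σ < σ₀ → ∀ (T : ℝ) (ρ θ : ℝ → (UnitAddTorus (Fin 3)) → ℝ) (u : ℝ → (UnitAddTorus (Fin 3)) → (EuclideanSpace ℝ (Fin 3))), Literature.MathematicalPhysics.KineticTheory.IsHardSphereEulerSolution σ T ρ u θ → ∀ Φ : (N : ℕ)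 → Literature.Analysis.FluidPDE.HardSphereFlow (Literature.Analysis.FluidPDE.Torus.geometry (Fin 3)) (Literature.MathematicalPhysics.KineticTheory.hsDiameter σ N) (N + 1), Literature.MathematicalPhysics.KineticTheory.TendstoHydroFieldsAt (fun N => Literature.MathematicalPhysics.KineticTheory.localGibbsLaw σ a₀ u₀ θ₀ N (Φ N)) Φ ρ u θ 0 → ∀ t : ℝ, 0 < t → t < T → (∀ s ∈ Icc 0 t, ∀ x, 2 * ρ s x * σ ^ 3 < η₁) → (∃ lam Cexp : ℝ, 0 < lam ∧ Tendsto (fun N : ℕ => Literature.MathematicalPhysics.KineticTheory.localGibbsLaw σ a₀ u₀ θ₀ N (Φ N) {z | Cexp < ∫ s in Icc 0 t, ∫ y, Real.exp (lam * ‖y.2‖ ^ 2) ∂(Literature.Analysis.FluidPDE.empiricalMeasure ((Φ N).flow s z))}) atTop (𝓝 0)) ∧ (∀ (γ C : ℝ) (φ : ℕ → (UnitAddTorus (Fin 3)) → ℝ), 0 < γ → γ ≤ 1 / 15 → ((∀ N, Literature.Analysis.FunctionSpaces.Torus.IsSmooth (φ N)) ∧ (∀ N y, 0 ≤ φ N y)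 ∧ (∀ N, ∫ y, φ N y = 1) ∧ (∀ (N : ℕ) y, ((N : ℝ) + 1) ^ (-γ) ≤ Literature.Analysis.FluidPDE.Torus.euclidDist y 0 → φ N y = 0) ∧ (∀ (N : ℕ) y, φ N y ≤ C * ((N : ℝ) + 1) ^ (3 * γ)) ∧ (∀ (N : ℕ) y, ‖Literature.Analysis.FunctionSpaces.Torus.gradient (φ N) y‖ ≤ C * ((N : ℝ) + 1) ^ (4 * γ))) → ∃ c₁ : ℝ, 0 < c₁ ∧ Tendsto (fun N : ℕ => Literature.MathematicalPhysics.KineticTheory.localGibbsLaw σ a₀ u₀ θ₀ N (Φ N) {z | ∃ s ∈ Icc 0 t, ∃ x : (UnitAddTorus (Fin 3)), Literature.MathematicalPhysics.KineticTheory.empiricalDensityField ((Φ N).flow s z) (fun y => φ N (y - x)) < c₁ ∨ 1 < Literature.MathematicalPhysics.KineticTheory.empiricalDensityField ((Φ N).flow s z) (fun y => φ N (y - x)) * σ ^ 3}) atTop (𝓝 0))) ∧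
    (∃ η₁ : ℝ, 0 < η₁ ∧ ∀ (a₀ θ₀ : (UnitAddTorus (Fin 3)) → ℝ) (u₀ : (UnitAddTorus (Fin 3)) → (EuclideanSpace ℝ (Fin 3))), Continuous a₀ → Continuous θ₀ → Continuous u₀ → (∀ x, 0 < a₀ x) → (∀ x, 0 < θ₀ x) → ∃ σ₀ : ℝ, 0 < σ₀ ∧ ∀ σ : ℝ, 0 < σ → σ < σ₀ → ∀ (T : ℝ) (ρ θ : ℝ → (UnitAddTorus (Fin 3)) → ℝ) (u : ℝ → (UnitAddTorus (Fin 3)) → (EuclideanSpace ℝ (Fin 3))), Literature.MathematicalPhysics.KineticTheory.IsHardSphereEulerSolution σ T ρ u θ → ∀ Φ : (N : ℕ) → Literature.Analysis.FluidPDE.HardSphereFlow (Literature.Analysis.FluidPDE.Torus.geometry (Fin 3)) (Literature.MathematicalPhysics.KineticTheory.hsDiameter σ N) (N + 1), Literature.MathematicalPhysics.KineticTheory.TendstoHydroFieldsAt (fun N => Literature.MathematicalPhysics.KineticTheory.localGibbsLaw σ a₀ u₀ θ₀ N (Φ N)) Φ ρ u θ 0 → ∀ (γ C : ℝ) (φ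 : ℕ → (UnitAddTorus (Fin 3)) → ℝ), 0 < γ → γ ≤ 1 / 15 → ((∀ N, Literature.Analysis.FunctionSpaces.Torus.IsSmooth (φ N)) ∧ (∀ N y, 0 ≤ φ N y) ∧ (∀ N, ∫ y, φ N y = 1) ∧ (∀ (N : ℕ) y, ((N : ℝ) + 1) ^ (-γ) ≤ Literature.Analysis.FluidPDE.Torus.euclidDist y 0 → φ N y = 0) ∧ (∀ (N : ℕ) y, φ N y ≤ C * ((N : ℝ) + 1) ^ (3 * γ)) ∧ (∀ (N : ℕ) y, ‖Literature.Analysis.FunctionSpaces.Torus.gradient (φ N) y‖ ≤ C * ((N : ℝ) + 1) ^ (4 * γ))) → let ρb := fun (N : ℕ) (z : Literature.Analysis.FluidPDE.Config (N + 1) (Fin 3) (UnitAddTorus (Fin 3))) (x : (UnitAddTorus (Fin 3))) => Literature.MathematicalPhysics.KineticTheory.empiricalDensityField z (fun y => φ N (y - x)); let mb := fun (N : ℕ) (z : Literature.Analysis.FluidPDE.Config (N + 1) (Fin 3) (UnitAddTorus (Fin 3))) (x : (UnitAddTorus (Fin 3))) => Literature.MathematicalPhysics.KineticTheory.empiricalMomentumField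 z (fun y => φ N (y - x)); let ub := fun (N : ℕ) (z : Literature.Analysis.FluidPDE.Config (N + 1) (Fin 3) (UnitAddTorus (Fin 3))) (x : (UnitAddTorus (Fin 3))) => (ρb N z x)⁻¹ • mb N z x; let D := fun (N : ℕ) (z : Literature.Analysis.FluidPDE.Config (N + 1) (Fin 3) (UnitAddTorus (Fin 3))) (x : (UnitAddTorus (Fin 3))) (j k : Fin 3) => (∫ y, φ N (y.1 - x) * ((y.2 j - ub N z x j) * (y.2 k - ub N z x k)) ∂(Literature.Analysis.FluidPDE.empiricalMeasure z)) - (if j = k then (∑ l : Fin 3, ∫ y, φ N (y.1 - x) * (y.2 l - ub N z x l) ^ 2 ∂(Literature.Analysis.FluidPDE.empiricalMeasure z)) / 3 else 0); let q := fun (N : ℕ) (z : Literature.Analysis.FluidPDE.Config (N + 1) (Fin 3) (UnitAddTorus (Fin 3))) (x : (UnitAddTorus (Fin 3))) => ∫ y, (φ N (y.1 - x) * ‖y.2 - ub N z x‖ ^ 2 / 2) • (y.2 - ub N z x) ∂(Literature.Analysis.FluidPDE.empiricalMeasure z); ∀ t : ℝ, 0 < t → t < T → (∀ s ∈ Icc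 0 t, ∀ x, 2 * ρ s x * σ ^ 3 < η₁) → ∀ δ : ℝ, 0 < δ → Tendsto (fun N : ℕ => Literature.MathematicalPhysics.KineticTheory.localGibbsLaw σ a₀ u₀ θ₀ N (Φ N) {z | δ < ∫ s in Icc 0 t, ∫ x, ((∑ j, ∑ k, D N ((Φ N).flow s z) x j k ^ 2) + ‖q N ((Φ N).flow s z) x‖ ^ 2)}) atTop (𝓝 0)) := by
  sorry

/-! ## Composition (pure logic) -/

/-- **The crux from the stub**: `MacroClosureInBand` is PROVED (`macroClosureInBand_proof`, landed); the UNIFORM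
kinetic inputs (`stub_uniformKineticInputs`) are exactly its two kinetic antecedents; the per-profile hypotheses
`hA`, `hF` of the crux as typed are implied by, and discarded in favour of, the uniform inputs
(`UniformDock.MacroClosure_of_subs`). [folklore] -/
theorem MacroClosure_of : MacroClosure := by
  obtain ⟨hAu, hFu⟩ := stub_uniformKineticInputs
  exact macroClosure_of_uniformInputs hAu hFu

end Barycentric

end Summit.AtomisticToContinuum.HydrodynamicLimit.Theorems.MacroClosureLine

end
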